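import Literature.AnabelianGeometry.SemiGraphs.TemperedAnabelian
import Mathlib.NumberTheory.Padics.Complex
import Mathlib.Algebra.Module.Equiv.Basic
import HarnessLib

/-!
# Joshi, *Arithmetic Teichmüller spaces I* — the SPACE `𝔍(X,E)`, its points (untilts), and the
# `Aut_{𝒪_E}(𝒢(𝒪_F))`-action ("many copies with distinct arithmetic"), typed as Lean structures

Record file of the abc-iut cell, branch E (seat abc-iut-E-t1; rung LADDER-ABC:A2.E). TAKES NO SIDE on
[IUTchIII] Cor. 3.12 or on any author (Mochizuki / Scholze–Stix / Joshi); typed ≠ proved ≠ endorsed.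
Source: K. Joshi, *Construction of Arithmetic Teichmuller Spaces and some applications* (unrefereed arXiv
preprint 2106.11452, the version held by the cell as `paper:arxiv-2106.11452`, corpus-TeX render
`HOME/lit/renders/Joshi-arxiv-2106.11452/pNNNN.txt`, 33 chunks; the TeX labels `(thm:main)` … are the
render's; locators are "§N, label, chunk"). Claim status of the series: rejected by the IUT author
[Mochizuki2024JoshiReport], accepted by neither side of the dispute (D-0012) — every property Joshi ASSERTS
is a named `Prop` here, never an axiom, instance or theorem. [claim: Joshi2021ATS1, status: disputed]

WHAT IS TYPED (one declaration per printed item; inventory `HOME/plan/E/t1/INVENTORY.tsv`, rows J1:…):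

* §1 `Untilt p` — "algebraically closed perfectoid field `K` [of characteristic `0`, residue characteristic
  `p`]" (§3, chunk p0008). By Joshi's §3 Lemma ("(1) `K` algebraically closed, complete with respect to a rank
  one non-archimedean valuation with residue characteristic `p` ⟺ (2) `K` algebraically closed perfectoid")
  this is typed CONCRETELY by Mathlib classes: `NormedField`, `CompleteSpace`, `IsUltrametricDist`,
  `IsAlgClosed`, `CharZero`, and `‖p‖ < 1`. `Untilt.TopIso` = "topologically isomorphic" (the relation whose
  failure [KedlayaTemkin2018] drives the paper); `Untilt.padicComplex` = Mathlib's `ℂ_[p]` is a kernel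
  WITNESS (so nothing below quantifies over an empty type).
* §2 `ATSObj X` — the objects of **`𝔍(X,E)`** (§8 (pa:teich-def), chunk p0019; Thm (th:main4.5-const-local-teich),
  chunks p0022–p0023): "triples `(Y/E′, E′ ↪ K)` consisting of `Y/E′` a geometrically connected, smooth,
  quasi-projective [hyperbolic] curve over a `p`-adic field `E′`, `K` an algebraically closed perfectoid field
  … and an isomorphism of the tempered fundamental groups `Π^temp(Y/E′) ≅ Π^temp(X/E)`". The curve WITH its
  tempered fundamental group is the tree's `Literature.AnabelianGeometry.SemiGraphs.TemperedCurve p`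
  ([SemiAnbd] §6 interface: `PiTemp`, augmentation to `G_{ℚ_p}`, `DeltaTemp`) — which is exactly the
  group datum of Joshi's "untilt of `Π`" (§4, chunk p0013: "`Π^temp(X/E)` together with
  `1 → Π^temp(X/K) → Π^temp(X/E) → G_E → 1`"; by §3 Thm (thm:main) (2),(4) the geometric subgroup does not
  depend on `K`, so a "labeled isomorph `Π^temp(X/E;K)`" is honestly the PAIR (group datum, label `K`)).
  `ATSObj.Iso` = "isomorphisms of the triples [defined in the obvious way]" (READING, see its docstring);
  `ATSObj.self`/`nonempty` = §8 Prop "`𝔍(X,E) ≠ ∅`" (chunk p0019) — a THEOREM here (object `(X, ℂ_p, id)`).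
* §3 `AnabelianVariation` — §7 (chunk p0017) "anabelian variation providing `Π` with base `S`", `IsTrivial`,
  `IsGeometric`; `ATSObj.variation` = Thm (th:main4.5) (1) "`𝔍(X,E)` is an anabelian variation providing
  `Π = Π^temp(X/E)`" (definitional), with base the forgetful functor to perfectoid fields ((pa:fibered-struct)
  (3), chunk p0020); `not_isTrivial_of_exists_not_topIso` = Joshi's route §3 Thm (thm:main2) ⇒ non-trivial.
* SEQUEL `ArithTeichmullerAction` (same seat): §8 Thm (th:main3) — the degree-one points `|𝒴_{F,E}|` of
  the Fargues–Fontaine curve, `𝒢(𝒪_F)`, "`|𝒴_{F,E}| = (𝒢(𝒪_F) − {0})/𝒪_E^*`" and the DEFINED action of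
  `Aut_{𝒪_E}(𝒢(𝒪_F))` on `𝔍(X,E)_F` (Cor (co:action-on-cpt-cat)); Prop (pr:belyi) (the `Aut(Π)`-action).

INTERFACE BOUNDARY / deliberately NOT here: Berkovich analytic spaces and §3 Thm (thm:main2) itself
(`X^an/K₁ ≇ X^an/K₂` over `ℚ_p`) — only its USE (objects with non-homeomorphic `K` are non-isomorphic,
`ATSObj.not_isIso_of_not_topIso`, a triviality of the typing); the tilt `K^♭` and `ι : K^♭ ≅ F` (in the sequel
an object of `𝔍(X,E)_F` is typed as living over a POINT `y` of the Fargues–Fontaine curve, whose residue field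
is an untilt of `F` by [FarguesFontaine2018]); §9 (functors to Mochizuki's anabelian landscape, prime-strips
à la Joshi), §10 (theta-values locus — heading E2, seat abc-iut-E-t3), §11 (self-similarity).
Nothing here mentions the Cor. 3.12 vocabulary (`Cor312.Setting`, `PilotKummerIndRelated`): the dictionary is
heading E3 (plan/E/README.md §3) and is typed separately, so that no test against `S` is prejudged here.
-/

noncomputable section

namespace Summit.ABC.IUTFork.Joshi

open Literature.AnabelianGeometry.SemiGraphs (TemperedCurve)

universe u

/-! ## 1. Untilts: algebraically closed perfectoid fields of characteristic zero (ATS I §3) -/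

/-- **An algebraically closed perfectoid field `K` of characteristic `0` and residue characteristic `p`**
(ATS I §3, chunk p0008: "In what follows I will work with algebraically closed, perfectoid fields of
characteristic zero. A typical example of such a field is … `ℂ_p`"), typed through Joshi's own §3 Lemma:
"(1) `K` is an algebraically closed field, complete with respect to a rank one non-archimedean valuation
with residue characteristic `p > 0` ⟺ (2) `K` is an algebraically closed, perfectoid field" [proof there from
[Scholze2012Perfectoid]]. So: a complete ultrametric normed field, algebraically closed, of characteristic
`0`, with `‖p‖ < 1`. Joshi calls such `K` an UNTILT (of its tilt `K^♭`; §3: "by an untilt of `F`, I will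
mean a perfectoid field `K`, of characteristic zero, with `K^♭` isometric with `F`"); the tilt is not
recorded here (see `UntiltPoints`). [claim: Joshi2021ATS1, status: disputed] -/
structure Untilt (p : ℕ) [Fact p.Prime] : Type 1 where
  /-- the field `K` -/
  K : Type
  [normedField : NormedField K]
  [completeSpace : CompleteSpace K]
  [isUltrametricDist : IsUltrametricDist K]
  [isAlgClosed : IsAlgClosed K]
  [charZero : CharZero K]
  /-- residue characteristic `p`: the valuation of `K` restricts on `ℚ ⊆ K` to (a power of) the `p`-adic one -/
  norm_p_lt_one : ‖(p : K)‖ < 1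

namespace Untilt

attribute [instance] normedField completeSpace isUltrametricDist isAlgClosed charZero

variable {p : ℕ} [Fact p.Prime]

/-- A **topological isomorphism** of untilts: a field isomorphism that is a homeomorphism for the valuation
topologies (ATS I §3, chunk p0008: untilts "are abstractly isomorphic fields but may not be topologically
isomorphic"; chunk p0013: "not topologically isomorphic (and hence non-isometric)"). [claim: Joshi2021ATS1, status: disputed] -/
structure TopEquiv (U V : Untilt p) : Type where
  /-- the field isomorphism -/
  toRingEquiv : U.K ≃+* V.K
  /-- … is continuous -/
  continuous_toFun : Continuous toRingEquiv
  /-- … with continuous inverse -/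
  continuous_invFun : Continuous toRingEquiv.symm

/-- "`K₁`, `K₂` are topologically isomorphic" (as valued fields). [claim: Joshi2021ATS1, status: disputed] -/
@[claim "Joshi2021ATS1" "disputed"]
def TopIso (U V : Untilt p) : Prop := Nonempty (TopEquiv U V)

/-- The identity is a topological isomorphism. [folklore] -/
def TopEquiv.refl (U : Untilt p) : TopEquiv U U :=
  ⟨RingEquiv.refl U.K, continuous_id, continuous_id⟩

/-- Inverse of a topological isomorphism. [folklore] -/
def TopEquiv.symm {U V : Untilt p} (e : TopEquiv U V) : TopEquiv V U :=
  ⟨e.toRingEquiv.symm, e.continuous_invFun, e.continuous_toFun⟩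

/-- Composite of topological isomorphisms. [folklore] -/
def TopEquiv.trans {U V W : Untilt p} (e : TopEquiv U V) (f : TopEquiv V W) : TopEquiv U W :=
  ⟨e.toRingEquiv.trans f.toRingEquiv, f.continuous_toFun.comp e.continuous_toFun,
    e.continuous_invFun.comp f.continuous_invFun⟩

/-- `TopIso` is reflexive. [folklore] -/
theorem TopIso.refl (U : Untilt p) : U.TopIso U := ⟨TopEquiv.refl U⟩

/-- `TopIso` is symmetric. [folklore] -/
theorem TopIso.symm {U V : Untilt p} (h : U.TopIso V) : V.TopIso U := ⟨h.some.symm⟩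

/-- `TopIso` is transitive. [folklore] -/
theorem TopIso.trans {U V W : Untilt p} (h : U.TopIso V) (h' : V.TopIso W) : U.TopIso W :=
  ⟨h.some.trans h'.some⟩

variable (p) in
/-- **`ℂ_p` is an untilt** in the typed sense (ATS I §3, chunk p0008: "A typical example of such a field is the
completed algebraic closure `ℂ_p` of `ℚ_p`"): Mathlib's `ℂ_[p] = PadicComplex p` is a complete ultrametric
normed field, algebraically closed, of characteristic zero, with `‖p‖ = ‖p‖_{ℚ_p} < 1`. A kernel WITNESS that
the type `Untilt p` is inhabited. [folklore] -/
def padicComplex : Untilt p where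
  K := ℂ_[p]
  norm_p_lt_one := by
    have h : ((p : ℚ_[p]) : ℂ_[p]) = (p : ℂ_[p]) := map_natCast (algebraMap ℚ_[p] ℂ_[p]) p
    rw [← h, PadicComplex.norm_extends']
    exact Padic.norm_p_lt_one

end Untilt

/-! ## 2. The arithmetic Teichmüller space `𝔍(X,E)`: objects, isomorphisms, non-emptiness (ATS I §8) -/

variable {p : ℕ} [Fact p.Prime]

/-- **An object of Joshi's arithmetic Teichmüller space `𝔍(X,E)`** of the hyperbolic curve `X/E` over the
`p`-adic field `E = X.K` (ATS I §8 (pa:teich-def), chunk p0019; Thm (th:main4.5-const-local-teich), chunk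
p0022: "objects of `𝔍(X,E)` are triples `(Y/E′, E′ ↪ K)` consisting of `Y/E′` a geometrically connected,
smooth, quasi-projective curve over a `p`-adic field `E′`, `K` is an algebraically closed perfectoid field with
an isometric embedding `E ↪ K` and an isomorphism of the tempered fundamental groups `Π^temp(Y/E′) ≅
Π^temp(X/E)`"; §3 chunk p0008: the embeddings are "continuous embeddings `E ↪ K` with the valuation of `K`
providing a valuation on `E` which is equivalent to the natural `p`-adic valuation"). The curve `Y/E′` WITH
its tempered fundamental group is the tree's [SemiAnbd] §6 interface `TemperedCurve p` (`Y.K = E′` a finite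
extension of `ℚ_p` inside the fixed `AlgebraicClosure ℚ_[p]`, `Y.PiTemp = Π^temp(Y/E′)` with its augmentation
to `G_{ℚ_p}`); continuity of `E′ ↪ K` is recorded on `ℚ_p ⊆ E′` (it then holds on the finite extension `E′`
for the unique extension of the valuation — Joshi's own remark, chunk p0009: "any abstract isomorphism of
finite extensions of a complete discretely valued field is in fact an isometry"). The "label" `α` is the
datum that makes `𝔍(X,E)` "an anabelian variation providing `Π^temp(X/E)`" (§7). [claim: Joshi2021ATS1, status: disputed] -/
structure ATSObj (X : TemperedCurve p) : Type 1 where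
  /-- the curve `Y/E′` with its tempered fundamental group (`E′ = Y.K`) -/
  Y : TemperedCurve p
  /-- the algebraically closed perfectoid field `K` -/
  U : Untilt p
  /-- the embedding `E′ ↪ K` -/
  emb : Y.K →+* U.K
  /-- … continuous on `ℚ_p` (the valuation of `K` induces on `E′` the `p`-adic topology) -/
  continuous_emb : Continuous fun x : ℚ_[p] => emb (algebraMap ℚ_[p] Y.K x)
  /-- the tempered anabelomorphism `Π^temp(Y/E′) ≅ Π^temp(X/E)` (an isomorphism of topological groups) -/
  α : Y.PiTemp ≃ₜ* X.PiTemp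

namespace ATSObj

variable {X : TemperedCurve p}

/-- **Isomorphisms of triples** (ATS I §8, chunk p0019: "morphisms between these objects will be isomorphisms of
the triples"; Thm (th:main4.5) "Morphisms between triples will be defined in the obvious way"). READING (print
gives no further detail): an isomorphism `(Y/E′, E′ ↪ K, α) ⥲ (Y₁/E′₁, E′₁ ↪ K₁, α₁)` consists of an isomorphism
of base fields `E′ ≅ E′₁`, a TOPOLOGICAL isomorphism of the perfectoid fields `K ≅ K₁` compatible with the
embeddings, and an isomorphism of tempered fundamental groups `Π^temp(Y/E′) ≅ Π^temp(Y₁/E′₁)` compatible with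
the labels (what an isomorphism of curves `Y ≅ Y₁` over `E′ ≅ E′₁` induces; the curves themselves are behind
the `TemperedCurve` interface). Faithfulness of this reading is for the referee lanes. [claim: Joshi2021ATS1, status: disputed] -/
structure Iso (A B : ATSObj X) : Type where
  /-- `E′ ≅ E′₁` -/
  baseEquiv : A.Y.K ≃+* B.Y.K
  /-- `K ≅ K₁`, topologically -/
  fieldEquiv : A.U.TopEquiv B.U
  /-- compatibility with the embeddings `E′ ↪ K`, `E′₁ ↪ K₁` -/
  emb_comm : ∀ x, fieldEquiv.toRingEquiv (A.emb x) = B.emb (baseEquiv x)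
  /-- `Π^temp(Y/E′) ≅ Π^temp(Y₁/E′₁)` -/
  piEquiv : A.Y.PiTemp ≃ₜ* B.Y.PiTemp
  /-- compatibility with the labels `α`, `α₁` -/
  α_comm : ∀ g, B.α (piEquiv g) = A.α g

/-- "`A` and `B` are isomorphic in `𝔍(X,E)`". [claim: Joshi2021ATS1, status: disputed] -/
@[claim "Joshi2021ATS1" "disputed"]
def IsIso (A B : ATSObj X) : Prop := Nonempty (Iso A B)

/-- Every object is isomorphic to itself. [folklore] -/
def Iso.refl (A : ATSObj X) : Iso A A where
  baseEquiv := RingEquiv.refl _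
  fieldEquiv := Untilt.TopEquiv.refl A.U
  emb_comm _ := rfl
  piEquiv := ContinuousMulEquiv.refl _
  α_comm _ := rfl

/-- `IsIso` is reflexive. [folklore] -/
theorem IsIso.refl (A : ATSObj X) : A.IsIso A := ⟨Iso.refl A⟩

/-- Isomorphic objects have topologically isomorphic perfectoid fields (the forgetful functor
`(Y/E′, E′ ↪ K) ↦ K`, (pa:fibered-struct) (3), chunk p0020). [folklore] -/
theorem IsIso.topIso {A B : ATSObj X} (h : A.IsIso B) : A.U.TopIso B.U := ⟨h.some.fieldEquiv⟩

/-- THE USE of §3 Thm (thm:main2) in the construction (chunk p0011: for `K₁`, `K₂` "not topologically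
isomorphic … the analytic spaces `X^an/K₁` and `X^an/K₂` are not isomorphic"; §4 chunk p0013: "these arise
from possibly distinct geometric spaces"): objects with non-homeomorphic perfectoid fields are NOT isomorphic
in `𝔍(X,E)` — for the typed `Iso` a triviality. [claim: Joshi2021ATS1, status: disputed] -/
theorem not_isIso_of_not_topIso {A B : ATSObj X} (h : ¬ A.U.TopIso B.U) : ¬ A.IsIso B :=
  fun hAB => h hAB.topIso

/-- The forgetful functor to `p`-adic fields, `(Y/E′, E′ ↪ K) ↦ E′` ((pa:fibered-struct) (2), chunk p0020), on
objects. [claim: Joshi2021ATS1, status: disputed] -/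
def baseField (A : ATSObj X) : IntermediateField ℚ_[p] (AlgebraicClosure ℚ_[p]) := A.Y.K

/-- The labeling function `V ↦ Π_V` of §7 (chunk p0017) on objects: the tempered fundamental group
`Π^temp(Y/E′)` of the object, an isomorph of `Π^temp(X/E)` via `α`. [claim: Joshi2021ATS1, status: disputed] -/
def grp (A : ATSObj X) : Type := A.Y.PiTemp

/-- **The geometric subgroup provided by the object** (Thm (th:main4.5) (1), chunk p0022: "the algebraically
closed perfectoid field `K` also provides the geometric tempered fundamental subgroup `Π^temp(Y/K) ↪
Π^temp(Y/E′)`. So the data `(Y/E′, E′ ↪ K)` provides an isomorph of `Π^temp(X/E)` and a preferred geometric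
subgroup"): by §3 Thm (thm:main) (1),(2) (chunks p0008–p0009) `Π^temp(Y/K) ≅ lim_{E″/E′} Π^temp(Y/E″)` is the
kernel of the augmentation WHATEVER `K` is — the tree's `TemperedCurve.DeltaTemp`, transported to `Π^temp(X/E)`
by the label. [claim: Joshi2021ATS1, status: disputed] -/
def geomSubgroup (A : ATSObj X) : Subgroup X.PiTemp := A.Y.DeltaTemp.map A.α.toMonoidHom

/-- §8 Prop (chunk p0019) "one may take `Y = X` and thus [𝔍(X,E)] is always non-empty as it contains triples
`(X, E, K)`": the object `(X/E, E ↪ K, id)` for any untilt `K` receiving `E` continuously.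
[claim: Joshi2021ATS1, status: disputed] -/
def self (X : TemperedCurve p) (U : Untilt p) (emb : X.K →+* U.K)
    (h : Continuous fun x : ℚ_[p] => emb (algebraMap ℚ_[p] X.K x)) : ATSObj X :=
  ⟨X, U, emb, h, ContinuousMulEquiv.refl _⟩

/-- The embedding `E = X.K ⊆ Q̄_p ↪ ℂ_p` (Mathlib: `AlgebraicClosure ℚ_[p] = PadicAlgCl p → ℂ_[p]`). [folklore] -/
def embPadicComplex (X : TemperedCurve p) : X.K →+* (Untilt.padicComplex p).K :=
  (UniformSpace.Completion.coeRingHom (α := PadicAlgCl p)).comp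
    (show X.K →+* PadicAlgCl p from X.K.val.toRingHom)

/-- … is continuous on `ℚ_p` (it is `ℚ_p ⊆ Q̄_p ⊆ ℂ_p`). [folklore] -/
theorem continuous_embPadicComplex (X : TemperedCurve p) :
    Continuous fun x : ℚ_[p] => embPadicComplex X (algebraMap ℚ_[p] X.K x) := by
  have h1 : Continuous (algebraMap ℚ_[p] (PadicAlgCl p)) := continuous_algebraMap ℚ_[p] (PadicAlgCl p)
  have h2 : Continuous ((↑) : PadicAlgCl p → ℂ_[p]) := UniformSpace.Completion.continuous_coe _
  refine (h2.comp h1).congr fun x => ?_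
  show ((algebraMap ℚ_[p] (PadicAlgCl p) x : PadicAlgCl p) : ℂ_[p]) =
    ((X.K.val (algebraMap ℚ_[p] X.K x) : PadicAlgCl p) : ℂ_[p])
  rw [AlgHom.commutes]

/-- **`𝔍(X,E) ≠ ∅`** (§8 Prop, chunk p0019) — a THEOREM for the typing: `(X/E, E ↪ ℂ_p, id)` is an object.
[claim: Joshi2021ATS1, status: disputed] -/
theorem nonempty (X : TemperedCurve p) : Nonempty (ATSObj X) :=
  ⟨self X (Untilt.padicComplex p) (embPadicComplex X) (continuous_embPadicComplex X)⟩

end ATSObj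

/-! ## 3. Anabelian variations providing `Π` (ATS I §7) -/

/-- **An anabelian variation providing `Π` with base `S`** (ATS I §7, chunk p0017): "Suppose `𝒞` is a category
and `Π` is a fixed pro-discrete group. … (1) For every `V` in `𝒞` there exists an isomorphism of pro-discrete
groups `α_V : Π_V ⥲ Π`, i.e. one is given a function `ob(𝒞) → [Π]` written `V ↦ Π_V` …; (2) There is a
functor `𝒞 → S` denoted `V ↦ [V] ∈ S`. In this case `[V]` [is] called the scheme (resp. `ℂ`-analytic space,
`ℚ_p`-analytic space) underlying `V`." Typed on objects: the objects and isomorphism relation of `𝒞`, the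
labelled groups, the base objects with their isomorphism relation, and functoriality of `[−]` on isomorphisms.
[claim: Joshi2021ATS1, status: disputed] -/
structure AnabelianVariation (Pi : Type) [Group Pi] [TopologicalSpace Pi] : Type (u + 2) where
  /-- objects of `𝒞` -/
  Obj : Type (u + 1)
  /-- "`V`, `V′` are isomorphic in `𝒞`" -/
  IsIso : Obj → Obj → Prop
  /-- the group `Π_V` -/
  grp : Obj → Type u
  [group : ∀ V, Group (grp V)]
  [topologicalSpace : ∀ V, TopologicalSpace (grp V)]
  /-- the label `α_V : Π_V ⥲ Π` -/
  label : ∀ V, grp V ≃ₜ* Pi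
  /-- objects of the base `S` -/
  Base : Type (u + 1)
  /-- "`[V]`, `[V′]` are isomorphic (equal) in `S`" -/
  BaseIso : Base → Base → Prop
  /-- the functor `V ↦ [V]` on objects -/
  base : Obj → Base
  /-- … takes isomorphisms to isomorphisms -/
  base_iso : ∀ V V', IsIso V V' → BaseIso (base V) (base V')

namespace AnabelianVariation

attribute [instance] group topologicalSpace

variable {Pi : Type} [Group Pi] [TopologicalSpace Pi] (C : AnabelianVariation.{u} Pi)

/-- "a trivial anabelian variation providing `Π` if any pair of objects `V, V′ ∈ 𝒞` are isomorphic" (§7,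
chunk p0017). [claim: Joshi2021ATS1, status: disputed] -/
@[claim "Joshi2021ATS1" "disputed"]
def IsTrivial : Prop := ∀ V V' : C.Obj, C.IsIso V V'

/-- "a geometric anabelian variation providing `Π` with base `S` if there exists `V, V′ ∈ 𝒞` such that
`[V] ≠ [V′]` (in `S`)" (§7, chunk p0017). [claim: Joshi2021ATS1, status: disputed] -/
@[claim "Joshi2021ATS1" "disputed"]
def IsGeometric : Prop := ∃ V V' : C.Obj, ¬ C.BaseIso (C.base V) (C.base V')

/-- "Obviously any geometric anabelian variation providing `Π` is non-trivial" (§7, chunk p0017). [claim: Joshi2021ATS1, status: disputed] -/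
theorem not_isTrivial_of_isGeometric (h : C.IsGeometric) : ¬ C.IsTrivial := by
  obtain ⟨V, V', hVV'⟩ := h
  exact fun ht => hVV' (C.base_iso V V' (ht V V'))

end AnabelianVariation

namespace ATSObj

variable (X : TemperedCurve p)

/-- **Thm (th:main4.5-const-local-teich) (1)** (chunk p0022; §7 (pa:arithmetic-topological-anabelian-var),
chunk p0018): "The category `𝔍(X,E)` is an anabelian variation providing `Π = Π^temp(X/E)`", with base the
forgetful functor "(Y/E′, E′ ↪ K) ↦ K (i.e. to algebraically closed perfectoid fields of characteristic zero)"
((pa:fibered-struct) (3), chunk p0020), perfectoid fields compared up to topological isomorphism — Joshi's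
"arithmetic-topological anabelian variation (of the geometric overfields) providing `Π`". A DEFINITION here
(the structure is assembled from the typed objects). [claim: Joshi2021ATS1, status: disputed] -/
def variation : AnabelianVariation.{0} X.PiTemp where
  Obj := ATSObj X
  IsIso := IsIso
  grp A := A.Y.PiTemp
  label A := A.α
  Base := Untilt p
  BaseIso := Untilt.TopIso
  base A := A.U
  base_iso _ _ h := h.topIso

/-- Joshi's route to non-triviality (§7 chunk p0018: "if the minimal prescription is augmented by the data of
… perfectoid … fields then one can construct an anabelian variation providing `Π` which is non-trivial (using
Theorem (thm:main2) or [kedlaya18])"): two objects with non-homeomorphic perfectoid fields make `𝔍(X,E)`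
geometric over the perfectoid base, hence non-trivial. The EXISTENCE of such fields is [KedlayaTemkin2018]
(`UntiltPoints.ExistsNonIsomorphic` below), not proved here. [claim: Joshi2021ATS1, status: disputed] -/
theorem not_isTrivial_of_exists_not_topIso (h : ∃ A B : ATSObj X, ¬ A.U.TopIso B.U) :
    ¬ (variation X).IsTrivial :=
  (variation X).not_isTrivial_of_isGeometric h

end ATSObj

end Summit.ABC.IUTFork.Joshi

end
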